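import Mathlib
import Literature.Analysis.FunctionSpaces.ContDiffHolderInterpolation
import Literature.Analysis.FunctionSpaces.ContDiffHolderExp
import Literature.Geometry.Symplectic.AlmostComplexTangentBundle
import Literature.Geometry.Symplectic.JHolomorphicRegularityHolderAux
import Literature.Geometry.Symplectic.JHolomorphicRegularityHolderLoc
import HarnessLib

/-!
# Elliptic bootstrapping for `J`-holomorphic curves in Hölder classes: limits and frames

Two ingredients of the difference-quotient step of the Hölder bootstrapping for
`J`-holomorphic curves (McDuff–Salamon 2012, Thm. B.4.1):

* `differentiableAt_of_holder_approx` — if `C¹` maps `vₙ` converge uniformly to `w` and their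
  derivatives are bounded and `s`-Hölder on a disc, uniformly in `n`, then `w` is differentiable
  on the disc of half the radius with the same bounds for `Dw` (interpolation makes `(Dvₙ)`
  uniformly Cauchy there — no subsequence is needed);
* `exists_linearCR_frame` — for a family `A(z)` of linear complex structures on `ℝ⁴` of class
  `C^{1,r}` near `z₀`, a global `C^{1,r}` frame `Θ(z) : ℂ² → ℝ⁴` with a `C¹` inverse family and
  explicit bounds, conjugating `A(z)` to `i` on a small disc around `z₀`
  (`Θ(z) = (1 + χ(z) (½ (1 - A(z) A(z₀)) - 1)) ∘ Θ₀` with a cutoff `χ` and a complex-linear model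
  `Θ₀ : (ℂ², i) ≅ (ℝ⁴, A(z₀))`).

## References

* D. McDuff, D. Salamon, *J-holomorphic curves and symplectic topology*, 2nd ed. (2012),
  App. B.4, Thm. B.4.1. [McDuffSalamon2012]
* D. Gilbarg, N. S. Trudinger, *Elliptic Partial Differential Equations of Second Order* (2001),
  Lemma 6.35. [GilbargTrudinger2001]
-/

noncomputable section

open Set Metric Filter Function Complex
open scoped Topology NNReal ContDiff

namespace Literature.Geometry.Symplectic

open Literature.Analysis.FunctionSpaces

section Limit

variable {Y : Type*} [NormedAddCommGroup Y] [NormedSpace ℝ Y] [CompleteSpace Y]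

/-- **Differentiability of a uniform limit with uniformly Hölder derivatives.** Let
`vₙ : ℂ → Y` be differentiable with `‖vₙ - w‖_∞ ≤ εₙ → 0`, and suppose that on the disc
`B(z₀, ρ)` the derivatives satisfy `‖Dvₙ‖ ≤ B` and `‖Dvₙ z - Dvₙ z'‖ ≤ B ‖z - z'‖ ^ s` (`s > 0`)
uniformly in `n`. Then `w` is differentiable on `B(z₀, ρ/2)` with `‖Dw‖ ≤ B` and
`‖Dw z - Dw z'‖ ≤ B ‖z - z'‖ ^ s` there: by the interpolation inequality
`norm_fderiv_le_of_modulus` the `Dvₙ` are uniformly Cauchy on the smaller disc, and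
`hasFDerivAt_of_tendstoUniformlyOn` applies. [cite: GilbargTrudinger2001, Lemma 6.35] -/
theorem differentiableAt_of_holder_approx {v : ℕ → ℂ → Y} {w : ℂ → Y} {z₀ : ℂ} {ρ B s : ℝ}
    {ε : ℕ → ℝ} (hρ : 0 < ρ) (hs : 0 < s) (hv : ∀ n, Differentiable ℝ (v n))
    (happrox : ∀ n z, ‖v n z - w z‖ ≤ ε n) (hε : Tendsto ε atTop (𝓝 0))
    (hB₀ : ∀ n, ∀ z ∈ ball z₀ ρ, ‖fderiv ℝ (v n) z‖ ≤ B)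
    (hB₁ : ∀ n, ∀ z ∈ ball z₀ ρ, ∀ z' ∈ ball z₀ ρ,
      ‖fderiv ℝ (v n) z - fderiv ℝ (v n) z'‖ ≤ B * ‖z - z'‖ ^ s) :
    (∀ z ∈ ball z₀ (ρ / 2), DifferentiableAt ℝ w z) ∧
      (∀ z ∈ ball z₀ (ρ / 2), ‖fderiv ℝ w z‖ ≤ B) ∧
      ∀ z ∈ ball z₀ (ρ / 2), ∀ z' ∈ ball z₀ (ρ / 2),
        ‖fderiv ℝ w z - fderiv ℝ w z'‖ ≤ B * ‖z - z'‖ ^ s := by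
  have hB : 0 ≤ B := (norm_nonneg _).trans (hB₀ 0 z₀ (mem_ball_self hρ))
  set S := ball z₀ (ρ / 2) with hS
  have hSρ : S ⊆ ball z₀ ρ := ball_subset_ball (by linarith)
  -- pointwise convergence `vₙ → w`
  have hpt : ∀ z, Tendsto (fun n => v n z) atTop (𝓝 (w z)) := fun z => by
    rw [tendsto_iff_norm_sub_tendsto_zero]
    exact squeeze_zero (fun n => norm_nonneg _) (fun n => happrox n z) hε
  -- the derivatives are uniformly Cauchy on `S`
  have hU : UniformCauchySeqOn (fun n => fderiv ℝ (v n)) atTop S := by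
    rw [Metric.uniformCauchySeqOn_iff]
    intro δ hδ
    -- the scale `h ≤ ρ / 2` with `2 B h ^ s ≤ δ / 3`
    obtain ⟨h, hh, hhρ, hω⟩ : ∃ h : ℝ, 0 < h ∧ h ≤ ρ / 2 ∧ 2 * B * h ^ s ≤ δ / 3 := by
      have hq : 0 < δ / (3 * (2 * B + 1)) := by positivity
      set h₁ := (δ / (3 * (2 * B + 1))) ^ s⁻¹ with hh₁
      have hh₁0 : 0 < h₁ := Real.rpow_pos_of_pos hq _
      refine ⟨min h₁ (ρ / 2), lt_min hh₁0 (by linarith), min_le_right _ _, ?_⟩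
      have hle : (min h₁ (ρ / 2)) ^ s ≤ h₁ ^ s :=
        Real.rpow_le_rpow (le_min hh₁0.le (by linarith)) (min_le_left _ _) hs.le
      have h1 : 2 * B / (2 * B + 1) ≤ 1 := (div_le_one (by positivity)).2 (by linarith)
      calc 2 * B * (min h₁ (ρ / 2)) ^ s ≤ 2 * B * h₁ ^ s := by gcongr
        _ = 2 * B * (δ / (3 * (2 * B + 1))) := by rw [hh₁, Real.rpow_inv_rpow hq.le hs.ne']
        _ = δ / 3 * (2 * B / (2 * B + 1)) := by field_simp
        _ ≤ δ / 3 * 1 := by gcongr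
        _ = δ / 3 := mul_one _
    -- uniform closeness of the values
    have hη : 0 < δ * h / 24 := by positivity
    obtain ⟨N, hN⟩ := (Metric.tendsto_atTop.1 hε) (δ * h / 24) hη
    have hN' : ∀ n ≥ N, ∀ m ≥ N, ∀ x, ‖v n x - v m x‖ ≤ δ * h / 12 := by
      intro n hn m hm x
      have h1 := hN n hn
      have h2 := hN m hm
      rw [Real.dist_eq, sub_zero] at h1 h2
      calc ‖v n x - v m x‖ = ‖(v n x - w x) - (v m x - w x)‖ := by rw [sub_sub_sub_cancel_right]
        _ ≤ ‖v n x - w x‖ + ‖v m x - w x‖ := norm_sub_le _ _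
        _ ≤ ε n + ε m := add_le_add (happrox n x) (happrox m x)
        _ ≤ δ * h / 24 + δ * h / 24 := add_le_add (le_abs_self _ |>.trans h1.le)
            (le_abs_self _ |>.trans h2.le)
        _ = δ * h / 12 := by ring
    refine ⟨N, fun n hn m hm x hx => ?_⟩
    have hdiff : Differentiable ℝ fun y => v n y - v m y := (hv n).sub (hv m)
    have hfd : ∀ y, fderiv ℝ (fun y => v n y - v m y) y = fderiv ℝ (v n) y - fderiv ℝ (v m) y :=
      fun y => fderiv_fun_sub ((hv n) y) ((hv m) y)
    have hball : closedBall x h ⊆ ball z₀ ρ := by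
      intro y hy
      rw [mem_closedBall, dist_eq_norm] at hy
      have hx' := mem_ball_iff_norm.1 hx
      rw [mem_ball_iff_norm]
      calc ‖y - z₀‖ ≤ ‖y - x‖ + ‖x - z₀‖ := norm_sub_le_norm_sub_add_norm_sub _ _ _
        _ < h + ρ / 2 := by linarith
        _ ≤ ρ := by linarith
    have hmod : ∀ y ∈ closedBall x h, ‖fderiv ℝ (fun y => v n y - v m y) y -
        fderiv ℝ (fun y => v n y - v m y) x‖ ≤ 2 * B * h ^ s := by
      intro y hy
      have hy' := hball hy
      have hx' := hSρ hx
      rw [hfd, hfd]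
      rw [mem_closedBall, dist_eq_norm] at hy
      calc ‖fderiv ℝ (v n) y - fderiv ℝ (v m) y - (fderiv ℝ (v n) x - fderiv ℝ (v m) x)‖
          = ‖(fderiv ℝ (v n) y - fderiv ℝ (v n) x) - (fderiv ℝ (v m) y - fderiv ℝ (v m) x)‖ := by
            congr 1
            abel
        _ ≤ ‖fderiv ℝ (v n) y - fderiv ℝ (v n) x‖ + ‖fderiv ℝ (v m) y - fderiv ℝ (v m) x‖ :=
            norm_sub_le _ _
        _ ≤ B * ‖y - x‖ ^ s + B * ‖y - x‖ ^ s :=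
            add_le_add (hB₁ n y hy' x hx') (hB₁ m y hy' x hx')
        _ ≤ B * h ^ s + B * h ^ s := by
            have : ‖y - x‖ ^ s ≤ h ^ s := Real.rpow_le_rpow (norm_nonneg _) hy hs.le
            gcongr
        _ = 2 * B * h ^ s := by ring
    have key := norm_fderiv_le_of_modulus hdiff hh (fun y => hN' n hn m hm y) x hmod
    rw [dist_eq_norm, ← hfd]
    calc ‖fderiv ℝ (fun y => v n y - v m y) x‖ ≤ 2 * (δ * h / 12) / h + 2 * B * h ^ s := key
      _ = δ / 6 + 2 * B * h ^ s := by
          congr 1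
          field_simp
          ring
      _ < δ := by linarith
  -- the limit of the derivatives on `S`, and differentiability of `w`
  have hlim : ∀ x ∈ S, ∃ L, Tendsto (fun n => fderiv ℝ (v n) x) atTop (𝓝 L) := fun x hx =>
    cauchySeq_tendsto_of_complete (hU.cauchySeq hx)
  choose! D hD using hlim
  have hunif : TendstoUniformlyOn (fun n => fderiv ℝ (v n)) D atTop S :=
    hU.tendstoUniformlyOn_of_tendsto hD
  have hderiv : ∀ x ∈ S, HasFDerivAt w (D x) x := fun x hx =>
    hasFDerivAt_of_tendstoUniformlyOn isOpen_ball hunif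
      (fun n x _ => ((hv n) x).hasFDerivAt) (fun x _ => hpt x) hx
  refine ⟨fun z hz => (hderiv z hz).differentiableAt, fun z hz => ?_, fun z hz z' hz' => ?_⟩
  · rw [(hderiv z hz).fderiv]
    exact le_of_tendsto' (hD z hz).norm fun n => hB₀ n z (hSρ hz)
  · rw [(hderiv z hz).fderiv, (hderiv z' hz').fderiv]
    exact le_of_tendsto' ((hD z hz).sub (hD z' hz')).norm fun n => hB₁ n z (hSρ hz) z' (hSρ hz')

end Limit

section Frame

/-- Local notation for the model space `ℝ⁴`. -/
local notation "E4" => EuclideanSpace ℝ (Fin 4)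

/-- **A complex-linear model `(ℂ², i) ≅ (ℝ⁴, J₀)`** of a linear complex structure `J₀` on `ℝ⁴`:
a real-linear homeomorphism `Θ₀ : ℂ × ℂ ≃L[ℝ] ℝ⁴` with `Θ₀ (i y) = J₀ (Θ₀ y)`. [folklore] -/
theorem exists_complexFrame_four (J₀ : E4 →L[ℝ] E4) (hJ₀ : ∀ v, J₀ (J₀ v) = -v) :
    ∃ Θ₀ : (ℂ × ℂ) ≃L[ℝ] E4, ∀ y, Θ₀ (I • y) = J₀ (Θ₀ y) := by
  have hfin : Module.finrank ℂ (Fin (Module.finrank ℝ E4 / 2) → ℂ) = Module.finrank ℂ (ℂ × ℂ) := by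
    rw [Module.finrank_fin_fun, finrank_euclideanSpace_fin, Module.finrank_prod, Module.finrank_self]
  set e : (Fin (Module.finrank ℝ E4 / 2) → ℂ) ≃L[ℂ] (ℂ × ℂ) := ContinuousLinearEquiv.ofFinrankEq hfin
  set L : E4 ≃ₗ[ℝ] (ℂ × ℂ) :=
    (complexModelIso J₀ hJ₀).toLinearEquiv.trans (e.toLinearEquiv.restrictScalars ℝ) with hL
  refine ⟨L.toContinuousLinearEquiv.symm, fun y => ?_⟩
  change L.symm (I • y) = J₀ (L.symm y)
  rw [hL, LinearEquiv.trans_symm, LinearEquiv.trans_apply, LinearEquiv.trans_apply,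
    LinearEquiv.restrictScalars_symm_apply, LinearEquiv.restrictScalars_symm_apply,
    ContinuousLinearEquiv.coe_symm_toLinearEquiv, ContinuousLinearEquiv.coe_symm_toLinearEquiv,
    map_smul, complexModelIso_symm_apply_I]

/-- The inverse of `1 - x` with `‖x‖ ≤ 1/2` has norm at most `2` (in the algebra of endomorphisms
of `ℝ⁴`). [folklore] -/
theorem norm_inverse_le_two_of_norm_sub_le {P : E4 →L[ℝ] E4} (hP : ‖1 - P‖ ≤ 1 / 2) :
    IsUnit P ∧ ‖Ring.inverse P‖ ≤ 2 := by
  have hu : IsUnit (1 - (1 - P)) := isUnit_one_sub_of_norm_lt_one (by linarith)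
  rw [sub_sub_cancel] at hu
  refine ⟨hu, ?_⟩
  set y := Ring.inverse P
  have hmul : P * y = 1 := Ring.mul_inverse_cancel _ hu
  have hy : y = 1 + (1 - P) * y := by rw [sub_mul, one_mul, hmul, add_sub_cancel]
  have h1 : ‖(1 : E4 →L[ℝ] E4)‖ ≤ 1 := ContinuousLinearMap.norm_id_le
  have hle : ‖y‖ ≤ 1 + 1 / 2 * ‖y‖ :=
    calc ‖y‖ = ‖1 + (1 - P) * y‖ := by rw [← hy]
      _ ≤ ‖(1 : E4 →L[ℝ] E4)‖ + ‖1 - P‖ * ‖y‖ := (norm_add_le _ _).trans (by gcongr; exact norm_mul_le _ _)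
      _ ≤ 1 + 1 / 2 * ‖y‖ := by gcongr
  linarith

-- a long elementary construction: twice the default heartbeat budget
set_option maxHeartbeats 400000 in
/-- **The conjugating frame.** Let `A(z)`, `z ∈ ℂ`, be linear complex structures on `ℝ⁴`
(`A(z)² = -1`) agreeing on a disc `B(z₀, ρ₀)` with a member `A'` of `C^{1,r}_b` (`0 < r ≤ 1`).
Then there are `0 < δ ≤ ρ₀ / 2`, `N ≥ 1`, a frame `Θ : ℂ → (ℂ² →L ℝ⁴)` of class `C¹` with
`‖Θ‖, ‖DΘ‖ ≤ N`, `[DΘ]_r ≤ N`, an inverse family `Θi` of class `C¹` with `‖Θi‖, ‖DΘi‖ ≤ N`,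
`‖A'‖, [A']_r ≤ N`, `Θi Θ = 1 = Θ Θi` everywhere, and `A' z ∘ Θ z = Θ z ∘ i` for `z ∈ B(z₀, δ)`. [folklore] -/
theorem exists_linearCR_frame {r : ℝ≥0} (hr1 : r ≤ 1) {A A' : ℂ → E4 →L[ℝ] E4}
    {z₀ : ℂ} {ρ₀ : ℝ} (hρ₀ : 0 < ρ₀) (hA2 : ∀ z v, A z (A z v) = -v)
    (hA' : MemContDiffHolder 1 r A') (hAA' : ∀ z ∈ ball z₀ ρ₀, A' z = A z) :
    ∃ (δ N : ℝ) (Θ : ℂ → (ℂ × ℂ) →L[ℝ] E4) (Θi : ℂ → E4 →L[ℝ] (ℂ × ℂ)),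
      0 < δ ∧ δ ≤ ρ₀ / 2 ∧ 1 ≤ N ∧ ContDiff ℝ 1 Θ ∧ (∀ z, ‖Θ z‖ ≤ N) ∧
      (∀ z, ‖fderiv ℝ Θ z‖ ≤ N) ∧
      (∀ z z', ‖fderiv ℝ Θ z - fderiv ℝ Θ z'‖ ≤ N * ‖z - z'‖ ^ (r : ℝ)) ∧
      ContDiff ℝ 1 Θi ∧ (∀ z, ‖Θi z‖ ≤ N) ∧ (∀ z, ‖fderiv ℝ Θi z‖ ≤ N) ∧
      (∀ z, ‖A' z‖ ≤ N) ∧ (∀ z z', ‖A' z - A' z'‖ ≤ N * ‖z - z'‖ ^ (r : ℝ)) ∧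
      (∀ z, (Θi z).comp (Θ z) = ContinuousLinearMap.id ℝ _) ∧
      (∀ z, (Θ z).comp (Θi z) = ContinuousLinearMap.id ℝ _) ∧
      ∀ z ∈ ball z₀ δ, ∀ y, A' z (Θ z y) = Θ z (I • y) := by
  -- the structure at the centre and its complex model
  set J₀ := A z₀ with hJ₀def
  have hJ₀ : ∀ v, J₀ (J₀ v) = -v := hA2 z₀
  have hJ₀sq : J₀ * J₀ = -1 := by
    ext1 v
    simp [hJ₀ v]
  obtain ⟨Θ₀, hΘ₀⟩ := exists_complexFrame_four J₀ hJ₀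
  -- smallness of `A' - J₀` near `z₀`
  set ε₀ : ℝ := 1 / (‖J₀‖ + 1) with hε₀
  have hε₀pos : 0 < ε₀ := by positivity
  have hA'c : Continuous A' := hA'.contDiff.continuous
  obtain ⟨δ₁, hδ₁, hδ₁A⟩ := Metric.continuousAt_iff.1 hA'c.continuousAt ε₀ hε₀pos
  set δ := min δ₁ (ρ₀ / 2) with hδdef
  have hδ : 0 < δ := lt_min hδ₁ (by linarith)
  have hδρ : δ ≤ ρ₀ / 2 := min_le_right _ _
  have hball : ∀ z ∈ ball z₀ δ, A' z = A z ∧ ‖A z - J₀‖ < ε₀ := by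
    intro z hz
    have hz₁ : dist z z₀ < δ₁ := (mem_ball.1 hz).trans_le (min_le_left _ _)
    have hzρ : z ∈ ball z₀ ρ₀ := ball_subset_ball (by linarith [min_le_right δ₁ (ρ₀ / 2)]) hz
    have h1 := hδ₁A hz₁
    rw [dist_eq_norm, hAA' z hzρ, hAA' z₀ (mem_ball_self hρ₀)] at h1
    exact ⟨hAA' z hzρ, h1⟩
  -- the cutoff
  have hKU : closedBall z₀ (δ / 2) ⊆ ball z₀ δ := closedBall_subset_ball (by linarith)
  obtain ⟨χ, hχ, hχc, hχU, hχ1, hχ01⟩ :=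
    exists_contDiff_one_nhdsSet_of_isCompact (isCompact_closedBall z₀ (δ / 2)) isOpen_ball hKU
  -- the interpolating operators `P z = 1 + χ z • (jInterp (A' z) J₀ - 1)`
  set Ψ : (E4 →L[ℝ] E4) → (E4 →L[ℝ] E4) := fun T => jInterp T J₀ - 1 with hΨ
  have hΨs : ContDiff ℝ (1 + 1) Ψ := by
    rw [hΨ]
    unfold jInterp
    exact ((contDiff_const.sub (contDiff_id.mul contDiff_const)).const_smul _).sub contDiff_const
  obtain ⟨P, hP⟩ : ∃ P : ℂ → E4 →L[ℝ] E4, P = fun z => 1 + χ z • Ψ (A' z) := ⟨_, rfl⟩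
  have hPval : ∀ z, P z = 1 + χ z • (jInterp (A' z) J₀ - 1) := fun z => by rw [hP]
  -- `‖P z - 1‖ ≤ 1/2`
  have hPsmall : ∀ z, ‖1 - P z‖ ≤ 1 / 2 := by
    intro z
    rw [hPval, sub_add_cancel_left, norm_neg, norm_smul]
    by_cases hχz : χ z = 0
    · rw [hχz, norm_zero, zero_mul]
      norm_num
    · have hz : z ∈ ball z₀ δ := hχU (subset_closure (mem_support.2 hχz))
      obtain ⟨hAz, hsmall⟩ := hball z hz
      set J₁ := A z
      have hJ₁sq : J₁ * J₁ = -1 := by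
        ext1 v
        simp [J₁, hA2 z v]
      have hid : jInterp J₁ J₀ - 1 = -((2⁻¹ : ℝ) • (J₁ * (J₀ - J₁))) := by
        unfold jInterp
        rw [mul_sub, hJ₁sq]
        module
      have hJ₁n : ‖J₁‖ ≤ ‖J₀‖ + 1 := by
        have h1 : ‖J₁‖ ≤ ‖J₁ - J₀‖ + ‖J₀‖ := norm_le_norm_sub_add _ _
        have h2 : ε₀ ≤ 1 := (div_le_one (by positivity)).2 (by linarith [norm_nonneg J₀])
        linarith
      have hχ1' : ‖χ z‖ ≤ 1 := by
        rw [Real.norm_of_nonneg (hχ01 z).1]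
        exact (hχ01 z).2
      rw [hAz, hid, norm_neg, norm_smul, Real.norm_of_nonneg (by norm_num : (0 : ℝ) ≤ 2⁻¹)]
      have hprod : ‖J₁ * (J₀ - J₁)‖ ≤ 1 :=
        calc ‖J₁ * (J₀ - J₁)‖ ≤ ‖J₁‖ * ‖J₀ - J₁‖ := norm_mul_le _ _
          _ ≤ (‖J₀‖ + 1) * ε₀ := by
              refine mul_le_mul hJ₁n ?_ (norm_nonneg _) (by positivity)
              rw [norm_sub_rev]
              exact hsmall.le
          _ = 1 := by rw [hε₀]; field_simp
      calc ‖χ z‖ * (2⁻¹ * ‖J₁ * (J₀ - J₁)‖) ≤ 1 * (2⁻¹ * 1) := by gcongr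
        _ = 1 / 2 := by norm_num
  have hPu : ∀ z, IsUnit (P z) ∧ ‖Ring.inverse (P z)‖ ≤ 2 := fun z =>
    norm_inverse_le_two_of_norm_sub_le (hPsmall z)
  -- regularity of `P`
  have hχm : MemContDiffHolder 1 r χ := MemContDiffHolder.of_contDiff_of_hasCompactSupport hχ hχc hr1
  have hΨA : MemContDiffHolder 1 r (Ψ ∘ A') := hA'.comp_left hr1 hΨs
  have hPm : MemContDiffHolder 1 r P := by
    have e : P = (fun _ => (1 : E4 →L[ℝ] E4)) + fun z => ContinuousLinearMap.lsmul ℝ ℝ (χ z) ((Ψ ∘ A') z) := by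
      rw [hP]
      rfl
    rw [e]
    exact (memContDiffHolder_const _).add (hχm.bilinear hr1 (ContinuousLinearMap.lsmul ℝ ℝ) hΨA)
  obtain ⟨a, ha, haP₀, haP₁, haP₂, haP₃⟩ := bounds_of_memContDiffHolder_one hr1 hPm
  have hPd : Differentiable ℝ P := hPm.contDiff.differentiable (by simp)
  -- the frame and its inverse
  set Θ₀c : (ℂ × ℂ) →L[ℝ] E4 := (Θ₀ : (ℂ × ℂ) →L[ℝ] E4) with hΘ₀c
  set Θ₀s : E4 →L[ℝ] (ℂ × ℂ) := (Θ₀.symm : E4 →L[ℝ] (ℂ × ℂ)) with hΘ₀s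
  set Θ : ℂ → (ℂ × ℂ) →L[ℝ] E4 := fun z => (P z).comp Θ₀c with hΘ
  set Θi : ℂ → E4 →L[ℝ] (ℂ × ℂ) := fun z => Θ₀s.comp (Ring.inverse (P z)) with hΘi
  -- regularity and bounds of `Θ`
  have hΘm : MemContDiffHolder 1 r Θ := hPm.clm_comp (ContinuousLinearMap.precomp E4 Θ₀c)
  obtain ⟨b, hb, hbΘ₀, hbΘ₁, hbΘ₂, -⟩ := bounds_of_memContDiffHolder_one hr1 hΘm
  -- regularity and bounds of `Θi`
  have hInvs : ContDiff ℝ 1 fun z => Ring.inverse (P z) := by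
    rw [contDiff_iff_contDiffAt]
    intro z
    obtain ⟨u, hu⟩ := (hPu z).1
    have h : ContDiffAt ℝ 1 Ring.inverse (P z) := hu ▸ contDiffAt_ringInverse ℝ u
    exact h.comp z hPm.contDiff.contDiffAt
  have hΘis : ContDiff ℝ 1 Θi := contDiff_const.clm_comp hInvs
  have hΘi₀ : ∀ z, ‖Θi z‖ ≤ ‖Θ₀s‖ * 2 := fun z =>
    (ContinuousLinearMap.opNorm_comp_le _ _).trans (mul_le_mul_of_nonneg_left (hPu z).2 (norm_nonneg _))
  -- `z ↦ (P z)⁻¹` is Lipschitz with constant `4a`, hence `‖DΘi‖ ≤ 4 a ‖Θ₀s‖`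
  have hInvL : ∀ z z', ‖Ring.inverse (P z) - Ring.inverse (P z')‖ ≤ 4 * a * ‖z - z'‖ := by
    intro z z'
    have hid : Ring.inverse (P z) - Ring.inverse (P z') =
        Ring.inverse (P z) * (P z' - P z) * Ring.inverse (P z') := by
      rw [mul_sub, sub_mul, mul_assoc, Ring.mul_inverse_cancel _ (hPu z').1, mul_one,
        Ring.inverse_mul_cancel _ (hPu z).1, one_mul]
    have hmv : ‖P z' - P z‖ ≤ a * ‖z' - z‖ :=
      convex_univ.norm_image_sub_le_of_norm_fderiv_le (fun x _ => hPd x) (fun x _ => haP₁ x)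
        (mem_univ z) (mem_univ z')
    rw [hid]
    calc ‖Ring.inverse (P z) * (P z' - P z) * Ring.inverse (P z')‖
        ≤ ‖Ring.inverse (P z)‖ * ‖P z' - P z‖ * ‖Ring.inverse (P z')‖ :=
          (norm_mul_le _ _).trans (mul_le_mul_of_nonneg_right (norm_mul_le _ _) (norm_nonneg _))
      _ ≤ 2 * (a * ‖z' - z‖) * 2 := by
          gcongr
          · exact (hPu z).2
          · exact (hPu z').2
      _ = 4 * a * ‖z - z'‖ := by rw [norm_sub_rev]; ring
  have hΘiL : LipschitzWith (‖Θ₀s‖ * (4 * a)).toNNReal Θi := by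
    refine LipschitzWith.of_dist_le_mul fun z z' => ?_
    rw [dist_eq_norm, dist_eq_norm, Real.coe_toNNReal _ (by positivity), hΘi]
    change ‖Θ₀s.comp (Ring.inverse (P z)) - Θ₀s.comp (Ring.inverse (P z'))‖ ≤ _
    rw [← ContinuousLinearMap.comp_sub]
    calc ‖Θ₀s.comp (Ring.inverse (P z) - Ring.inverse (P z'))‖
        ≤ ‖Θ₀s‖ * ‖Ring.inverse (P z) - Ring.inverse (P z')‖ := ContinuousLinearMap.opNorm_comp_le _ _
      _ ≤ ‖Θ₀s‖ * (4 * a * ‖z - z'‖) := by gcongr; exact hInvL z z'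
      _ = ‖Θ₀s‖ * (4 * a) * ‖z - z'‖ := by ring
  have hΘi₁ : ∀ z, ‖fderiv ℝ Θi z‖ ≤ ‖Θ₀s‖ * (4 * a) := fun z =>
    (norm_fderiv_le_of_lipschitz ℝ hΘiL).trans_eq (Real.coe_toNNReal _ (by positivity))
  -- bounds for `A'`
  obtain ⟨a', ha', haA₀, haA₁⟩ := bounds_of_memContDiffHolder_zero (hA'.of_succ hr1)
  -- the constant
  set N : ℝ := b + ‖Θ₀s‖ * 2 + ‖Θ₀s‖ * (4 * a) + a' + 1 with hN
  have hN1 : 1 ≤ N := by rw [hN]; nlinarith [norm_nonneg Θ₀s]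
  have hbN : b ≤ N := by rw [hN]; nlinarith [norm_nonneg Θ₀s]
  have h2N : ‖Θ₀s‖ * 2 ≤ N := by rw [hN]; nlinarith [norm_nonneg Θ₀s]
  have h4N : ‖Θ₀s‖ * (4 * a) ≤ N := by rw [hN]; nlinarith [norm_nonneg Θ₀s]
  have ha'N : a' ≤ N := by rw [hN]; nlinarith [norm_nonneg Θ₀s]
  have hd0 : ∀ z z' : ℂ, 0 ≤ ‖z - z'‖ ^ (r : ℝ) := fun z z' => Real.rpow_nonneg (norm_nonneg _) _
  refine ⟨δ / 2, N, Θ, Θi, half_pos hδ, by linarith [hδρ], hN1, hΘm.contDiff,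
    fun z => (hbΘ₀ z).trans hbN, fun z => (hbΘ₁ z).trans hbN,
    fun z z' => (hbΘ₂ z z').trans (mul_le_mul_of_nonneg_right hbN (hd0 z z')), hΘis,
    fun z => (hΘi₀ z).trans h2N, fun z => (hΘi₁ z).trans h4N, fun z => (haA₀ z).trans ha'N,
    fun z z' => (haA₁ z z').trans (mul_le_mul_of_nonneg_right ha'N (hd0 z z')),
    fun z => ?_, fun z => ?_, fun z hz y => ?_⟩
  · -- `Θi z ∘ Θ z = 1`
    rw [hΘi, hΘ]
    change (Θ₀s.comp (Ring.inverse (P z))).comp ((P z).comp Θ₀c) = _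
    rw [ContinuousLinearMap.comp_assoc, ← ContinuousLinearMap.comp_assoc _ (P z),
      ← ContinuousLinearMap.mul_def, Ring.inverse_mul_cancel _ (hPu z).1,
      ContinuousLinearMap.one_def, ContinuousLinearMap.id_comp, hΘ₀s, hΘ₀c]
    exact ContinuousLinearMap.ext fun y => by simp
  · -- `Θ z ∘ Θi z = 1`
    rw [hΘi, hΘ]
    change ((P z).comp Θ₀c).comp (Θ₀s.comp (Ring.inverse (P z))) = _
    rw [ContinuousLinearMap.comp_assoc, ← ContinuousLinearMap.comp_assoc Θ₀c, hΘ₀s, hΘ₀c]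
    have e : (Θ₀ : (ℂ × ℂ) →L[ℝ] E4).comp (Θ₀.symm : E4 →L[ℝ] (ℂ × ℂ)) =
        ContinuousLinearMap.id ℝ E4 := by
      ext1 x
      simp
    rw [e, ContinuousLinearMap.id_comp, ← ContinuousLinearMap.mul_def,
      Ring.mul_inverse_cancel _ (hPu z).1, ContinuousLinearMap.one_def]
  · -- conjugation on the small disc
    have hz' : z ∈ ball z₀ δ := ball_subset_ball (by linarith) hz
    obtain ⟨hAz, -⟩ := hball z hz'
    have hχz : χ z = 1 := (eventually_nhdsSet_iff_forall.1 hχ1) z (ball_subset_closedBall hz)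
      |>.self_of_nhds
    have hPz : P z = jInterp (A z) J₀ := by
      rw [hPval, hχz, one_smul, hAz, add_sub_cancel]
    have hJ₁sq : A z * A z = -1 := by
      ext1 v
      simp [hA2 z v]
    have hcomm : A z * P z = P z * J₀ := by rw [hPz]; exact mul_jInterp hJ₁sq hJ₀sq
    rw [hAz, hΘ]
    change A z (P z (Θ₀c y)) = P z (Θ₀c (I • y))
    rw [hΘ₀c]
    change A z (P z (Θ₀ y)) = P z (Θ₀ (I • y))
    calc A z (P z (Θ₀ y)) = (A z * P z) (Θ₀ y) := rfl
      _ = (P z * J₀) (Θ₀ y) := by rw [hcomm]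
      _ = P z (Θ₀ (I • y)) := by rw [hΘ₀ y]; rfl

end Frame

end Literature.Geometry.Symplectic
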